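import Summits.BirchSwinnertonDyer.BirchSwinnertonDyer.Theorems.PrintCf2RubinValueTwoTowerLift
import Summits.BirchSwinnertonDyer.BirchSwinnertonDyer.Theorems.PrintCf2RubinValueTwoRestrictedMainConjLinePushPseudoIso
import HarnessLib

/-!
# Route C `PrintCf2RubinValueTwo`, crux `RestrictedMainConjWithValueAtTwo` (stmt-BirchSwinnertonDyer-23722), brick (RES)(b) — the COKERNEL OF
# CONTROL IS LOCAL: `I ⧸ g(𝔖)` (the `γ₁`-invariants of `H¹_nr(K̃_∞, M)` modulo restricted classes from the line `K_∞^{(2)}`) is a QUOTIENT of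
# the local-defect group `J ⧸ 𝔖`, `J = {y ∈ H¹(K_∞^{(2)}, M) : res y ∈ H¹_nr(K̃_∞, M)}` ⊇ `𝔖 = 𝔖_𝔮(K_∞^{(2)}, M)` — by the tower lift
# (p684615 `mem_range_resOfLe_pairKer_right_of_conjH1_eq`); hence brick (RES)'s pseudo-isomorphism holds as soon as `J ⧸ 𝔖` is finite

Cell `bsd-print-cf2`, width seat `bsd-line-cf2c-w8` g0 (prover-bsd-line-cf2c-w8-g0-0); `--supports stmt-BirchSwinnertonDyer-23722`. Sequel of
p683075 / p683924 / p684214 / p684615. HONEST FRAMING: nothing here closes the crux or the registered stub; BSD is not proved by any of this; no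
summit statement is proved by this seat. No definition, no named fact, no `sorry`. Generic: any number field `K`, any `p`, any discrete
`p`-primary `M` with open stabilisers and continuous orbits, any place `𝔮`, any generator pair `(κ₁, κ₂; γ₁, γ₂)` (line `κ₂`, LEAD (R-SEAM)).
* §1 `res_mem_ker_conjSel₂_sub_one` — a class over the line restricts to a `γ₁`-INVARIANT class (`γ₁ ∈ ker κ₂`); `exists_mem_comap_res_eq` — by the
  tower lift, EVERY `γ₁`-invariant class of `H¹_nr(K̃_∞, M)` is `res y` for some `y ∈ J := (unrSelmer₂).comap res`.
* §2 **`finite_cokerControl_of_finite_localDefect`** — `res` induces a SURJECTION `J ⧸ 𝔖 ↠ I ⧸ g(𝔖)`; so `Finite (J ⧸ 𝔖) → Finite (I ⧸ g(𝔖))`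
  with `#(I ⧸ g(𝔖)) ≤ #(J ⧸ 𝔖)`. What `J ⧸ 𝔖` IS: the classes over `K_∞^{(2)}` that are unramified over `K̃_∞` away from `p` and above `𝔮`,
  modulo those that are locally trivial away from `p` and strict above `𝔮` over `K_∞^{(2)}` — a purely LOCAL group (place by place:
  `H¹(G_w/I_w, M^{I_w})`-type defects), the last input of (RES).
* §3 (road α frames) **`exists_pseudoIso_of_finite_localDefect_of_frame`** — p683924's `exists_linearMap_quotSMulTop_of_frame` with its displayed
  hypothesis replaced by `Finite (J ⧸ 𝔖)`: the `Λ`-linear `f : QuotSMulTop T₁ D₂.X →ₗ[Λ] D.X` has pseudo-null kernel AND cokernel.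
presearch: Agboola 2007 §3 Prop. 3.2 (control for restricted Selmer groups: kernel `W*(K*_∞)`-bounded, cokernel local), Greenberg LNM 1716 §3
Lemmas 3.1–3.3 — held; tree assembly, no new fact. beyond-print theorem: no.

References: [Agboola2007] §3 Prop. 3.2, §4; [GreenbergLNM1716] §3 Lemmas 3.1–3.3; [SkinnerUrban2014] Prop. 3.2.8; [Rubin1991] §4.
-/

noncomputable section

open scoped Classical
-- the summit namespace `Summit.BirchSwinnertonDyer.BirchSwinnertonDyer` repeats the problem name by design (D-0017)
set_option linter.dupNamespace false
set_option autoImplicit false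

open NumberField IsDedekindDomain Field WeierstrassCurve
open Literature.NumberTheory.EllipticCurves Literature.NumberTheory.EllipticCurves.GreenbergSelmer
open Literature.NumberTheory.EllipticCurves.Agboola2007
open Literature.NumberTheory.EllipticCurves.IwasawaDual
open Literature.NumberTheory.GaloisRepresentations
open Summit.BirchSwinnertonDyer.BirchSwinnertonDyer.Theorems.PrintCf2.RestrictedSelmerPair

universe u

namespace Summit.BirchSwinnertonDyer.BirchSwinnertonDyer.Theorems.PrintCf2.LinePush

/-! ## §1. Restricted classes are `γ₁`-invariant; every `γ₁`-invariant class of `H¹_nr(K̃_∞, M)` lifts to `J` -/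

section Generic

variable {K : Type u} [Field K] [NumberField K] {p : ℕ} [Fact p.Prime] {κ₁ κ₂ : ZpExtension K p}
  {M : Type u} [AddCommGroup M] [DistribMulAction (absoluteGaloisGroup K) M] [TopologicalSpace M] [DiscreteTopology M]
  {𝔮 : HeightOneSpectrum (𝓞 K)} {γ₁ γ₂ : absoluteGaloisGroup K}

omit [NumberField K] in
/-- A class over the line `K_∞^{(2)}` restricts to a class of `H¹(K̃_∞, M)` FIXED by `conj_σ` for every `σ ∈ ker κ₂` — in particular by `γ₁`
(`res ∘ conj_σ = conj_σ ∘ res` and `conj_σ = id` on `H¹(ker κ₂, ·)`). [cite: SerreLocalFields1979, VII §5 Prop. 3] -/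
theorem conjH1_resOfLe_pairKer_right_of_mem {σ : absoluteGaloisGroup K} (hσ : σ ∈ κ₂.kerSubgroup) (y : subgroupH1 κ₂.kerSubgroup M) :
    conjH1 (ZpExtension.pairKer κ₁ κ₂) M σ (resOfLe M (ZpExtension.pairKer_le_right κ₁ κ₂) y) =
      resOfLe M (ZpExtension.pairKer_le_right κ₁ κ₂) y := by
  rw [← AddMonoidHom.comp_apply, ← resOfLe_comp_conjH1_holds (M := M) (ZpExtension.pairKer_le_right κ₁ κ₂) σ, AddMonoidHom.comp_apply,
    conjH1_of_mem_holds κ₂.kerSubgroup M hσ, AddMonoidHom.id_apply]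

/-- **Every `γ₁`-invariant class of `H¹_nr(K̃_∞, M)` is the restriction of a class over the line lying in `J := (unrSelmer₂).comap res`** (the
tower lift p684615 `mem_range_resOfLe_pairKer_right_of_conjH1_eq`; the lift lies in `J` because its restriction is the given class).
[cite: GreenbergLNM1716, §3 Lemma 3.2] [cite: Agboola2007, §3 Prop. 3.2] -/
theorem exists_mem_comap_resOfLe_eq (hγ : ZpExtension.IsTopGeneratorPair κ₁ κ₂ γ₁ γ₂)
    (hcont : ∀ m : M, Continuous fun g : absoluteGaloisGroup K ↦ g • m) (hprim : ∀ m : M, ∃ k : ℕ, p ^ k • m = 0)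
    (s : unrSelmer₂ κ₁ κ₂ M 𝔮) (hs : conjSel₂ κ₁ κ₂ M 𝔮 γ₁ s = s) :
    ∃ y : subgroupH1 κ₂.kerSubgroup M, y ∈ (unrSelmer₂ κ₁ κ₂ M 𝔮).comap (resOfLe M (ZpExtension.pairKer_le_right κ₁ κ₂)) ∧
      resOfLe M (ZpExtension.pairKer_le_right κ₁ κ₂) y = (s : subgroupH1 (ZpExtension.pairKer κ₁ κ₂) M) := by
  have hs' : conjH1 (ZpExtension.pairKer κ₁ κ₂) M γ₁ (s : subgroupH1 (ZpExtension.pairKer κ₁ κ₂) M) = s := by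
    have h := congrArg (fun t : unrSelmer₂ κ₁ κ₂ M 𝔮 ↦ (t : subgroupH1 (ZpExtension.pairKer κ₁ κ₂) M)) hs
    simpa only [coe_conjSel₂_apply] using h
  obtain ⟨y, hy⟩ := ZpExtension.mem_range_resOfLe_pairKer_right_of_conjH1_eq hγ hcont hprim _ hs'
  refine ⟨y, ?_, hy⟩
  rw [AddSubgroup.mem_comap, hy]
  exact s.2

/-! ## §2. The cokernel of control is a quotient of the local defect `J ⧸ 𝔖` -/

variable {g : restrictedSelmerZp κ₂ M 𝔮 →+ unrSelmer₂ κ₁ κ₂ M 𝔮}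
  (hg : ∀ t : restrictedSelmerZp κ₂ M 𝔮,
    ((g t : unrSelmer₂ κ₁ κ₂ M 𝔮) : subgroupH1 (ZpExtension.pairKer κ₁ κ₂) M) =
      resOfLe M (ZpExtension.pairKer_le_right κ₁ κ₂) (t : subgroupH1 κ₂.kerSubgroup M))
include hg

/-- **THE COKERNEL OF CONTROL IS A QUOTIENT OF THE LOCAL DEFECT.** Let `J := {y ∈ H¹(K_∞^{(2)}, M) : res y ∈ H¹_nr(K̃_∞, M)}`
(`(unrSelmer₂).comap res`; it contains `𝔖 = restrictedSelmerZp κ₂ M 𝔮` by p683075 `exists_lineRes_right`) and `I` = the `γ₁`-invariants of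
`H¹_nr(K̃_∞, M)`. Then `res` induces a SURJECTION `J ⧸ 𝔖 ↠ I ⧸ g(𝔖)` (§1: `res J ⊆ I`, every element of `I` lifts to `J`, `res = g` on `𝔖`), so
`I ⧸ g(𝔖)` is finite with `# ≤ #(J ⧸ 𝔖)` as soon as `J ⧸ 𝔖` is. `J ⧸ 𝔖` is the LOCAL defect: unramified-over-`K̃_∞` versus
locally-trivial/strict-over-`K_∞^{(2)}` at the finitely many relevant places — the remaining input of brick (RES).
[cite: Agboola2007, §3 Prop. 3.2 (arXiv p0008:L128–135)] [cite: GreenbergLNM1716, §3 Lemmas 3.2–3.3] -/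
theorem finite_cokerControl_of_finite_localDefect (hγ : ZpExtension.IsTopGeneratorPair κ₁ κ₂ γ₁ γ₂)
    (hcont : ∀ m : M, Continuous fun g : absoluteGaloisGroup K ↦ g • m) (hprim : ∀ m : M, ∃ k : ℕ, p ^ k • m = 0)
    [Finite (↥((unrSelmer₂ κ₁ κ₂ M 𝔮).comap (resOfLe M (ZpExtension.pairKer_le_right κ₁ κ₂))) ⧸
      (restrictedSelmerZp κ₂ M 𝔮).addSubgroupOf ((unrSelmer₂ κ₁ κ₂ M 𝔮).comap (resOfLe M (ZpExtension.pairKer_le_right κ₁ κ₂))))] :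
    Finite ((conjSel₂ κ₁ κ₂ M 𝔮 γ₁ - 1).ker ⧸ g.range.addSubgroupOf (conjSel₂ κ₁ κ₂ M 𝔮 γ₁ - 1).ker) ∧
      Nat.card ((conjSel₂ κ₁ κ₂ M 𝔮 γ₁ - 1).ker ⧸ g.range.addSubgroupOf (conjSel₂ κ₁ κ₂ M 𝔮 γ₁ - 1).ker) ≤
        Nat.card (↥((unrSelmer₂ κ₁ κ₂ M 𝔮).comap (resOfLe M (ZpExtension.pairKer_le_right κ₁ κ₂))) ⧸
          (restrictedSelmerZp κ₂ M 𝔮).addSubgroupOf ((unrSelmer₂ κ₁ κ₂ M 𝔮).comap (resOfLe M (ZpExtension.pairKer_le_right κ₁ κ₂)))) := by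
  set res := resOfLe M (ZpExtension.pairKer_le_right κ₁ κ₂) with hres
  set J : AddSubgroup (subgroupH1 κ₂.kerSubgroup M) := (unrSelmer₂ κ₁ κ₂ M 𝔮).comap res with hJ
  set I : AddSubgroup (unrSelmer₂ κ₁ κ₂ M 𝔮) := (conjSel₂ κ₁ κ₂ M 𝔮 γ₁ - 1).ker with hI
  -- `res` as a map `J → I`
  have hmemS : ∀ y : J, res (y : subgroupH1 κ₂.kerSubgroup M) ∈ unrSelmer₂ κ₁ κ₂ M 𝔮 := fun y ↦ AddSubgroup.mem_comap.mp y.2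
  have hmemI : ∀ y : J, (⟨res (y : subgroupH1 κ₂.kerSubgroup M), hmemS y⟩ : unrSelmer₂ κ₁ κ₂ M 𝔮) ∈ I := fun y ↦ by
    rw [hI, AddMonoidHom.mem_ker]
    change conjSel₂ κ₁ κ₂ M 𝔮 γ₁ ⟨res (y : subgroupH1 κ₂.kerSubgroup M), hmemS y⟩ -
      ⟨res (y : subgroupH1 κ₂.kerSubgroup M), hmemS y⟩ = 0
    rw [sub_eq_zero]
    apply Subtype.ext
    rw [coe_conjSel₂_apply]
    exact conjH1_resOfLe_pairKer_right_of_mem hγ.2.1 _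
  let Θ : J →+ I :=
    { toFun := fun y ↦ ⟨⟨res (y : subgroupH1 κ₂.kerSubgroup M), hmemS y⟩, hmemI y⟩
      map_zero' := Subtype.ext (Subtype.ext (by simp only [ZeroMemClass.coe_zero, map_zero]))
      map_add' := fun y y' ↦ Subtype.ext (Subtype.ext (by simp only [AddSubgroup.coe_add, map_add])) }
  have hΘ : ∀ y : J, (((Θ y : I) : unrSelmer₂ κ₁ κ₂ M 𝔮) : subgroupH1 (ZpExtension.pairKer κ₁ κ₂) M) =
      res (y : subgroupH1 κ₂.kerSubgroup M) := fun _ ↦ rfl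
  -- `Θ` is onto (tower lift)
  have hΘsurj : Function.Surjective Θ := by
    rintro ⟨s, hs⟩
    have hs' : conjSel₂ κ₁ κ₂ M 𝔮 γ₁ s = s := by
      rw [hI, AddMonoidHom.mem_ker] at hs
      change conjSel₂ κ₁ κ₂ M 𝔮 γ₁ s - s = 0 at hs
      rwa [sub_eq_zero] at hs
    obtain ⟨y, hyJ, hy⟩ := exists_mem_comap_resOfLe_eq hγ hcont hprim s hs'
    exact ⟨⟨y, hyJ⟩, Subtype.ext (Subtype.ext (by rw [hΘ]; exact hy))⟩
  -- `Θ` maps `𝔖` into `g(𝔖)`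
  have hΘS : ∀ y : J, (y : subgroupH1 κ₂.kerSubgroup M) ∈ restrictedSelmerZp κ₂ M 𝔮 → Θ y ∈ g.range.addSubgroupOf I := by
    intro y hy
    rw [AddSubgroup.mem_addSubgroupOf]
    refine ⟨⟨(y : subgroupH1 κ₂.kerSubgroup M), hy⟩, Subtype.ext ?_⟩
    rw [hg, ← hΘ]
  -- the induced surjection `J ⧸ 𝔖 ↠ I ⧸ g(𝔖)`
  let Θq : J ⧸ (restrictedSelmerZp κ₂ M 𝔮).addSubgroupOf J →+ I ⧸ g.range.addSubgroupOf I :=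
    QuotientAddGroup.map _ _ Θ fun y hy ↦ hΘS y (AddSubgroup.mem_addSubgroupOf.mp hy)
  have hΘq : Function.Surjective Θq := by
    intro q
    obtain ⟨i, rfl⟩ := QuotientAddGroup.mk_surjective q
    obtain ⟨y, rfl⟩ := hΘsurj i
    exact ⟨QuotientAddGroup.mk y, rfl⟩
  exact ⟨Finite.of_surjective Θq hΘq, Nat.card_le_card_of_surjective Θq hΘq⟩

end Generic

/-! ## §3. Road α frames: brick (RES)'s pseudo-isomorphism from the finiteness of the local defect -/

section Frame

variable {K : Type} [Field K] [NumberField K]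

/-- **BRICK (RES) ON THE FRAMES, modulo the LOCAL defect only.** Member `C • W = cm7^{(d)}`, `K` imaginary quadratic, `v`, `v̄` over `2`,
ANY `π, r` (`W* = ↥((W.baseChange K).endEigenPrimaryTorsion 2 π r)`), a generator pair `(κ₁, κ₂; γ₁, γ₂)` with `κ₁` unramified outside `v`
and the line `κ₂` unramified outside `v̄`, ANY `D₂ : DualData₂ κ₁ κ₂ W* v̄ γ₁ γ₂`, ANY `D : RestrictedDualData κ₂ W* v̄ γ₂`. IF the local defect
`J ⧸ 𝔖` is finite (`J` = classes over `K*_∞` unramified over `K̃_∞`, `𝔖 = 𝔖_v̄(K*_∞, W*)`), THEN the `Λ`-linear control map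
`f : QuotSMulTop T₁ D₂.X →ₗ[Λ] D.X` (transpose of restriction, `Λ` through `PowerSeries.C`) has PSEUDO-NULL KERNEL AND COKERNEL — the
TURNKEY's `restrictedDual_pseudoIso_quotSMulTop_of_frame` granted the local defect (p683924 + §2 + the tower lift p684615).
[cite: Agboola2007, §3 Prop. 3.2 and §4] [cite: SkinnerUrban2014, Prop. 3.2.8, Cor. 3.2.9] [cite: GreenbergLNM1716, §3 Lemmas 3.1–3.3] -/
theorem exists_pseudoIso_of_finite_localDefect_of_frame {d : ℤ} (hd0 : d ≠ 0) (W : WeierstrassCurve ℚ) [W.IsElliptic]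
    (C : VariableChange ℚ) (hC : C • W = cm7.quadraticTwist (d : ℚ)) (hK : IsImaginaryQuadratic K)
    (v vbar : HeightOneSpectrum (𝓞 K)) (hv : ((2 : ℕ) : 𝓞 K) ∈ v.asIdeal) (hvbar : ((2 : ℕ) : 𝓞 K) ∈ vbar.asIdeal)
    (π : (W.baseChange K).endRing) (r : ℤ_[2]) (κ₁ κ₂ : ZpExtension K 2) (hκ₁ : κ₁.IsUnramifiedOutside v)
    (hκ₂ : κ₂.IsUnramifiedOutside vbar) {γ₁ γ₂ : absoluteGaloisGroup K} (hγ : ZpExtension.IsTopGeneratorPair κ₁ κ₂ γ₁ γ₂)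
    (D₂ : DualData₂ κ₁ κ₂ ↥((W.baseChange K).endEigenPrimaryTorsion 2 π r) vbar γ₁ γ₂)
    (D : RestrictedDualData κ₂ ↥((W.baseChange K).endEigenPrimaryTorsion 2 π r) vbar γ₂)
    [Finite (↥((unrSelmer₂ κ₁ κ₂ ↥((W.baseChange K).endEigenPrimaryTorsion 2 π r) vbar).comap
        (resOfLe ↥((W.baseChange K).endEigenPrimaryTorsion 2 π r) (ZpExtension.pairKer_le_right κ₁ κ₂))) ⧸
      (restrictedSelmerZp κ₂ ↥((W.baseChange K).endEigenPrimaryTorsion 2 π r) vbar).addSubgroupOf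
        ((unrSelmer₂ κ₁ κ₂ ↥((W.baseChange K).endEigenPrimaryTorsion 2 π r) vbar).comap
          (resOfLe ↥((W.baseChange K).endEigenPrimaryTorsion 2 π r) (ZpExtension.pairKer_le_right κ₁ κ₂))))] :
    letI : Module (IwasawaAlgebra 2) (QuotSMulTop (PowerSeries.X : IwasawaAlgebra₂ 2) D₂.X) :=
      Module.compHom _ (PowerSeries.C (R := IwasawaAlgebra 2))
    ∃ (g : restrictedSelmerZp κ₂ ↥((W.baseChange K).endEigenPrimaryTorsion 2 π r) vbar →+
        unrSelmer₂ κ₁ κ₂ ↥((W.baseChange K).endEigenPrimaryTorsion 2 π r) vbar)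
      (f : QuotSMulTop (PowerSeries.X : IwasawaAlgebra₂ 2) D₂.X →ₗ[IwasawaAlgebra 2] D.X),
      (∀ t, ((g t : unrSelmer₂ κ₁ κ₂ ↥((W.baseChange K).endEigenPrimaryTorsion 2 π r) vbar) :
          subgroupH1 (ZpExtension.pairKer κ₁ κ₂) ↥((W.baseChange K).endEigenPrimaryTorsion 2 π r)) =
        resOfLe ↥((W.baseChange K).endEigenPrimaryTorsion 2 π r) (ZpExtension.pairKer_le_right κ₁ κ₂)
          (t : subgroupH1 κ₂.kerSubgroup ↥((W.baseChange K).endEigenPrimaryTorsion 2 π r))) ∧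
      (∀ (x : D₂.X) (t : restrictedSelmerZp κ₂ ↥((W.baseChange K).endEigenPrimaryTorsion 2 π r) vbar),
          D.toDual (f (Submodule.Quotient.mk x)) t = D₂.toDual x (g t)) ∧
      (Finite (LinearMap.ker f) ∧ Module.IsPseudoNull (IwasawaAlgebra 2) (LinearMap.ker f)) ∧
      (Finite (D.X ⧸ LinearMap.range f) ∧ Module.IsPseudoNull (IwasawaAlgebra 2) (D.X ⧸ LinearMap.range f)) := by
  have hcont : ∀ m : ↥((W.baseChange K).endEigenPrimaryTorsion 2 π r), Continuous fun σ : absoluteGaloisGroup K ↦ σ • m :=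
    continuous_smul_endEigenPrimaryTorsion (W.baseChange K) 2 π r
  have hprim : ∀ m : ↥((W.baseChange K).endEigenPrimaryTorsion 2 π r), ∃ k : ℕ, 2 ^ k • m = 0 :=
    exists_pow_smul_endEigenPrimaryTorsion_eq_zero (W.baseChange K) 2 π r
  refine (exists_linearMap_quotSMulTop_of_frame hd0 W C hC hK v vbar hv hvbar π r κ₁ κ₂ hκ₁ hκ₂ hγ D₂ D).elim fun g hg' ↦ ?_
  refine hg'.elim fun f hf ↦ ?_
  have hfinI := (finite_cokerControl_of_finite_localDefect hf.1 hγ hcont hprim).1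
  have hk := hf.2.2.2 hfinI
  exact ⟨g, f, hf.1, hf.2.1, ⟨hk.1, hk.2.1⟩, hf.2.2.1⟩

/-- **(RES) AS A PSEUDO-ISOMORPHISM AND THE CHARACTERISTIC-IDEAL IDENTITY, modulo the local defect** (appended for the (SP) assembler):
on the frames, if `J ⧸ 𝔖` is finite then `QuotSMulTop T₁ D₂.X` and `D.X` are PSEUDO-ISOMORPHIC `Λ`-modules (`Λ` through `PowerSeries.C`, the
`Module.compHom` structure of `charIdeal_le_map_constantCoeff_of_control`) and hence **`ch_Λ(D₂.X ⧸ T₁ D₂.X) = ch_Λ(D.X)`**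
(`Module.charIdeal_eq_of_arePseudoIsomorphic`) — the input shape of the Herbrand specialisation `charIdeal_quotSMulTop_eq_mul` /
S3n′ of TURNKEY §3. [cite: Agboola2007, §4] [cite: SkinnerUrban2014, Cor. 3.2.9 (ii) (p. 24)] [cite: JetchevSkinnerWan2017, Cor. 3.4.2] -/
theorem charIdeal_quotSMulTop_eq_of_finite_localDefect_of_frame {d : ℤ} (hd0 : d ≠ 0) (W : WeierstrassCurve ℚ) [W.IsElliptic]
    (C : VariableChange ℚ) (hC : C • W = cm7.quadraticTwist (d : ℚ)) (hK : IsImaginaryQuadratic K)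
    (v vbar : HeightOneSpectrum (𝓞 K)) (hv : ((2 : ℕ) : 𝓞 K) ∈ v.asIdeal) (hvbar : ((2 : ℕ) : 𝓞 K) ∈ vbar.asIdeal)
    (π : (W.baseChange K).endRing) (r : ℤ_[2]) (κ₁ κ₂ : ZpExtension K 2) (hκ₁ : κ₁.IsUnramifiedOutside v)
    (hκ₂ : κ₂.IsUnramifiedOutside vbar) {γ₁ γ₂ : absoluteGaloisGroup K} (hγ : ZpExtension.IsTopGeneratorPair κ₁ κ₂ γ₁ γ₂)
    (D₂ : DualData₂ κ₁ κ₂ ↥((W.baseChange K).endEigenPrimaryTorsion 2 π r) vbar γ₁ γ₂)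
    (D : RestrictedDualData κ₂ ↥((W.baseChange K).endEigenPrimaryTorsion 2 π r) vbar γ₂)
    [Finite (↥((unrSelmer₂ κ₁ κ₂ ↥((W.baseChange K).endEigenPrimaryTorsion 2 π r) vbar).comap
        (resOfLe ↥((W.baseChange K).endEigenPrimaryTorsion 2 π r) (ZpExtension.pairKer_le_right κ₁ κ₂))) ⧸
      (restrictedSelmerZp κ₂ ↥((W.baseChange K).endEigenPrimaryTorsion 2 π r) vbar).addSubgroupOf
        ((unrSelmer₂ κ₁ κ₂ ↥((W.baseChange K).endEigenPrimaryTorsion 2 π r) vbar).comap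
          (resOfLe ↥((W.baseChange K).endEigenPrimaryTorsion 2 π r) (ZpExtension.pairKer_le_right κ₁ κ₂))))] :
    letI : Module (IwasawaAlgebra 2) (QuotSMulTop (PowerSeries.X : IwasawaAlgebra₂ 2) D₂.X) :=
      Module.compHom _ (PowerSeries.C (R := IwasawaAlgebra 2))
    Module.ArePseudoIsomorphic (IwasawaAlgebra 2) (QuotSMulTop (PowerSeries.X : IwasawaAlgebra₂ 2) D₂.X) D.X ∧
      Module.charIdeal (IwasawaAlgebra 2) (QuotSMulTop (PowerSeries.X : IwasawaAlgebra₂ 2) D₂.X) =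
        Module.charIdeal (IwasawaAlgebra 2) D.X := by
  letI inst : Module (IwasawaAlgebra 2) (QuotSMulTop (PowerSeries.X : IwasawaAlgebra₂ 2) D₂.X) :=
    Module.compHom _ (PowerSeries.C (R := IwasawaAlgebra 2))
  refine (exists_pseudoIso_of_finite_localDefect_of_frame hd0 W C hC hK v vbar hv hvbar π r κ₁ κ₂ hκ₁ hκ₂ hγ D₂ D).elim fun g hg' ↦ ?_
  refine hg'.elim fun f hf ↦ ?_
  have hpi : Module.ArePseudoIsomorphic (IwasawaAlgebra 2) (QuotSMulTop (PowerSeries.X : IwasawaAlgebra₂ 2) D₂.X) D.X :=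
    ⟨f, hf.2.2.1.2, hf.2.2.2.2⟩
  exact ⟨hpi, Module.charIdeal_eq_of_arePseudoIsomorphic hpi⟩

end Frame

end Summit.BirchSwinnertonDyer.BirchSwinnertonDyer.Theorems.PrintCf2.LinePush
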